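import Literature.NumberTheory.Rogawski1990.TransferFactsCanonical
import HarnessLib

/-!
# The endoscopic torus isomorphism `Z_H(γ_H) ≅ Z_G(ι γ_H) ≅ Z_{G′}(γ)` for `G`-regular `γ_H ∈ H = U(J₂) × U(J₁)` matching `γ ∈ U(H′)`, on every carrier
(Rogawski, *Automorphic representations of unitary groups in three variables* (1990), §4.3 pp. 42–44: for `G`-regular `γ_H` the tori `T_H = H_{γ_H}` and
`T = G_γ` are identified and «the measures on `H_{γ_H}` and `G_γ` are compatible»; §4.8 Case (a) p. 53 the embedding `ι`; Langlands–Shelstad (1987), §1.3)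

Topic `NumberTheory/Rogawski1990`; namespace `Literature.NumberTheory.Rogawski1990`.  THEOREMS ONLY (existence form; no definition, no named fact, no
instance, no `sorry`).  The H-SIDE companion of ★ `StableCentralizerEquiv[CM]` (F0P3a-p04 (g3), O8 of the floor-0 line `F0_T1InnerFormTraceIdentity`),
which give `Z(γ) ≃ₜ* Z(γ′)` for corresponding regular elements of two unitary groups in `GL₃`; here the source is the ENDOSCOPIC group `H = U(J₂) × U(J₁)`
embedded by ★ `endoEmb` (block pattern `(* 0 *; 0 * 0; * 0 *)`).
* §0 (abstract groups): an injective (inducing) homomorphism `ι : A →* B` whose image contains `Z(ι a)` restricts to `Z(a) ≃* Z(ι a)` (`≃ₜ*`).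
* §1 (commutative ring `S`, `2 ∈ S^×`): for `a ∈ U(J₂) × U(J₁)` with commutative `GL₃`-commutant of `ι a` (`a` `G`-regular) **`Z(ι a) ⊆ range ι`** —
  `ι(1, −1) = diag(1, −1, 1)` commutes with `ι a`, hence with all of `Z(ι a)`, forcing the block pattern (★ `mem_range_endoEmb_iff_apply`); so
  `Z(a) ≃* Z(ι a)` (`≃ₜ*` over a `T₁` topological ring, ★ `isClosedEmbedding_endoEmb`).
* §2 the CM carriers of the line, composed with ★ (S-B) `rational∕local∕arch∕adelicStableCentralizerEquiv`: RATIONAL (★ `IsNormPair`), LOCAL (★ `IsLocalNormPair`,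
  ★ `IsLocalGRegular`), ARCHIMEDEAN (★ `IsArchNormPair`, ★ `IsArchGRegular`), ADELIC from rational data (★ `toAdelic_endoEmbRational`): `∃ e : Z_H(γ_H) ≃ₜ* Z_{G′}(γ)`
  with value `y · ι(z) · y⁻¹` for ANY conjugator `y`; the adelic `e` carries RATIONAL points onto rational points (`endoEmbAdelic_mem_arithmeticSubgroup_iff`)
  — the lattice hypothesis of ★ `Literature.MeasureTheory.Group.covolume_count_eq_of_mulEquiv` for print's equality of the torus covolumes entering `κ_H`.
* §3 the line's (C_H) datum ★ `endoEmbArchCentralizer L γ_H : Z_{H_∞}(γ_H) →* Z_{G_∞}(ι_∞ γ_H)` IS such an isomorphism for `G`-regular `γ_H` (bijective, an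
  embedding, a homeomorphism, underlying a `≃ₜ*`), and **`map (endoEmbArchCentralizer L γ_H) t` of a Haar measure is a Haar measure** — what makes ED 1.19a's
  archimedean coherence condition (C_H) a statement about Haar measures on the torus `T ≅ T_H`.

## References
* J. D. Rogawski, *Automorphic Representations of Unitary Groups in Three Variables*, Ann. of Math. Stud. 123 (1990), §4.3 pp. 42–44, §4.8 p. 53, §14.3 p. 234
  [Rogawski1990].
* R. P. Langlands, D. Shelstad, *On the definition of transfer factors*, Math. Ann. 278 (1987), §1.3 [LanglandsShelstad1987].
-/

noncomputable section

open NumberField IsDedekindDomain Topology MeasureTheory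
open scoped Matrix MatrixGroups

namespace Literature.NumberTheory.Rogawski1990

open Literature.AlgebraicGeometry.ShimuraVarieties (unitaryGroup mem_unitaryGroup_iff)
open Literature.NumberTheory.Automorphic Literature.NumberTheory.Automorphic.UnitaryGroup

/-! ## §0 Abstract: an injective homomorphism whose image contains `Z(ι a)` restricts to `Z(a) ≅ Z(ι a)` -/

section Abstract

variable {A B : Type*} [Group A] [Group B] (ι : A →* B)

/-- `ι` maps `Z(a)` into `Z(ι a)`. [cite: Rogawski1990, §4.3 p. 42] -/
theorem map_mem_centralizer_singleton (a : A) {z : A} (hz : z ∈ Subgroup.centralizer ({a} : Set A)) :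
    ι z ∈ Subgroup.centralizer ({ι a} : Set B) :=
  Subgroup.mem_centralizer_singleton_iff.mpr (by rw [← map_mul, ← map_mul, Subgroup.mem_centralizer_singleton_iff.mp hz])

/-- For injective `ι`: `ι z ∈ Z(ι a)` implies `z ∈ Z(a)`. [cite: Rogawski1990, §4.3 p. 42] -/
theorem mem_centralizer_singleton_of_map_mem (hinj : Function.Injective ι) (a : A) {z : A}
    (hz : ι z ∈ Subgroup.centralizer ({ι a} : Set B)) : z ∈ Subgroup.centralizer ({a} : Set A) :=
  Subgroup.mem_centralizer_singleton_iff.mpr (hinj (by rw [map_mul, map_mul]; exact Subgroup.mem_centralizer_singleton_iff.mp hz))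

/-- `ι` restricted to the centralisers `Z(a) →* Z(ι a)` is bijective when `ι` is injective and `Z(ι a) ⊆ range ι`. [cite: Rogawski1990, §4.3 p. 42] -/
theorem codRestrict_centralizer_bijective (hinj : Function.Injective ι) (a : A)
    (hsurj : ∀ w ∈ Subgroup.centralizer ({ι a} : Set B), w ∈ Set.range ι) :
    Function.Bijective ((ι.comp (Subgroup.centralizer ({a} : Set A)).subtype).codRestrict (Subgroup.centralizer ({ι a} : Set B))
      fun z => map_mem_centralizer_singleton ι a z.2) := by
  refine ⟨fun z w hzw => Subtype.ext (hinj (congrArg Subtype.val hzw)), fun w => ?_⟩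
  obtain ⟨z, hz⟩ := hsurj w w.2
  exact ⟨⟨z, mem_centralizer_singleton_of_map_mem ι hinj a (by rw [hz]; exact w.2)⟩, Subtype.ext hz⟩

/-- **Abstract `Z(a) ≃* Z(ι a)`**: an injective homomorphism `ι : A →* B` with `Z(ι a) ⊆ range ι` restricts to a group isomorphism of the centralisers
with underlying map `ι`. [cite: Rogawski1990, §4.3 pp. 42–44] -/
theorem exists_mulEquiv_centralizer_of_injective (hinj : Function.Injective ι) (a : A)
    (hsurj : ∀ w ∈ Subgroup.centralizer ({ι a} : Set B), w ∈ Set.range ι) :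
    ∃ e : Subgroup.centralizer ({a} : Set A) ≃* Subgroup.centralizer ({ι a} : Set B), ∀ z, (e z).1 = ι z.1 :=
  ⟨MulEquiv.ofBijective _ (codRestrict_centralizer_bijective ι hinj a hsurj), fun _ => rfl⟩

/-- **Abstract `Z(a) ≃ₜ* Z(ι a)`** for topological groups: if moreover `ι` is inducing (e.g. a closed embedding), the isomorphism is one of topological
groups. [cite: Rogawski1990, §4.3 pp. 42–44] -/
theorem exists_continuousMulEquiv_centralizer_of_isInducing [TopologicalSpace A] [TopologicalSpace B] (hι : IsInducing ι)
    (hinj : Function.Injective ι) (a : A) (hsurj : ∀ w ∈ Subgroup.centralizer ({ι a} : Set B), w ∈ Set.range ι) :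
    ∃ e : Subgroup.centralizer ({a} : Set A) ≃ₜ* Subgroup.centralizer ({ι a} : Set B), ∀ z, (e z).1 = ι z.1 := by
  have hind : IsInducing ((ι.comp (Subgroup.centralizer ({a} : Set A)).subtype).codRestrict (Subgroup.centralizer ({ι a} : Set B))
      fun z => map_mem_centralizer_singleton ι a z.2) :=
    (IsInducing.subtypeVal.of_comp_iff).mp (by
      change IsInducing (ι ∘ (Subtype.val : Subgroup.centralizer ({a} : Set A) → A))
      exact hι.comp IsInducing.subtypeVal)
  let e₀ := MulEquiv.ofBijective _ (codRestrict_centralizer_bijective ι hinj a hsurj)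
  let eh := e₀.toEquiv.toHomeomorphOfIsInducing hind
  exact ⟨{ e₀ with continuous_toFun := eh.continuous, continuous_invFun := eh.symm.continuous }, fun _ => rfl⟩

end Abstract

/-! ## §1 `Z_{U(J₃)}(ι a) ⊆ range ι` for `G`-regular `a`, over any commutative ring with `2` a unit -/

section Endo

variable {S : Type*} [CommRing S] (σ : S →+* S) {J₂ : Matrix (Fin 2) (Fin 2) S} {J₁ : Matrix (Fin 1) (Fin 1) S} {J₃ : Matrix (Fin 3) (Fin 3) S}
  (h : endoForm J₂ J₁ = J₃)

/-- `diag(1, −1, 1)` commutes with every matrix of the pattern `(* 0 *; 0 * 0; * 0 *)`, in particular with the matrix of `ι(a)`.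
[cite: Rogawski1990, §4.8 Case (a) p. 53] -/
theorem diag_commute_coe_endoEmb (a : unitaryGroupOfForm σ J₂ × unitaryGroupOfForm σ J₁) :
    Commute (!![1, 0, 0; 0, -1, 0; 0, 0, 1] : Matrix (Fin 3) (Fin 3) S)
      (((endoEmb σ J₂ J₁ J₃ h a : unitaryGroupOfForm σ J₃) : GL (Fin 3) S) : Matrix (Fin 3) (Fin 3) S) := by
  rw [coe_coe_endoEmb_eq]
  change _ * _ = _ * _
  ext i j
  fin_cases i <;> fin_cases j <;> simp [Matrix.mul_apply, Fin.sum_univ_three]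

/-- A `3 × 3` matrix commuting with `diag(1, −1, 1)` has the pattern `(* 0 *; 0 * 0; * 0 *)` when `2` is a unit.
[cite: Rogawski1990, §4.8 Case (a) p. 53] -/
theorem pattern_of_commute_diag (hS : IsUnit (2 : S)) {B : Matrix (Fin 3) (Fin 3) S} (hB : Commute B !![1, 0, 0; 0, -1, 0; 0, 0, 1]) :
    B 0 1 = 0 ∧ B 1 0 = 0 ∧ B 1 2 = 0 ∧ B 2 1 = 0 := by
  have h2 : ∀ x : S, x = -x → x = 0 := fun x hx => by
    have h' : (2 : S) * x = 0 := by rw [two_mul]; nth_rewrite 2 [hx]; exact add_neg_cancel x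
    exact (hS.mul_right_eq_zero).mp h'
  have e := hB.eq
  have e01 := congrFun (congrFun e 0) 1
  have e10 := congrFun (congrFun e 1) 0
  have e12 := congrFun (congrFun e 1) 2
  have e21 := congrFun (congrFun e 2) 1
  simp [Matrix.mul_apply, Fin.sum_univ_three] at e01 e10 e12 e21
  exact ⟨h2 _ e01.symm, h2 _ e10, h2 _ e12, h2 _ e21.symm⟩

variable {σ h}

/-- **The centraliser of `ι a` lies in the image of `ι`** when the `GL₃(S)`-commutant of `ι a` is commutative (`a` `G`-regular) and `2 ∈ S^×`:
`ι(1, −1)` commutes with `ι a`, hence with every `w ∈ Z(ι a)`, which forces the pattern `(* 0 *; 0 * 0; * 0 *)` on `w`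
(★ `mem_range_endoEmb_iff_apply`). [cite: Rogawski1990, §4.3 p. 42] -/
theorem mem_range_endoEmb_of_mem_centralizer (hS : IsUnit (2 : S)) (a : unitaryGroupOfForm σ J₂ × unitaryGroupOfForm σ J₁)
    (hcomm : ∀ B C : Matrix (Fin 3) (Fin 3) S,
      Commute B (((endoEmb σ J₂ J₁ J₃ h a : unitaryGroupOfForm σ J₃) : GL (Fin 3) S) : Matrix (Fin 3) (Fin 3) S) →
      Commute C (((endoEmb σ J₂ J₁ J₃ h a : unitaryGroupOfForm σ J₃) : GL (Fin 3) S) : Matrix (Fin 3) (Fin 3) S) → Commute B C)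
    {w : unitaryGroupOfForm σ J₃} (hw : w ∈ Subgroup.centralizer ({endoEmb σ J₂ J₁ J₃ h a} : Set (unitaryGroupOfForm σ J₃))) :
    w ∈ Set.range (endoEmb σ J₂ J₁ J₃ h) := by
  rw [mem_range_endoEmb_iff_apply]
  refine pattern_of_commute_diag hS (hcomm _ _ ?_ (diag_commute_coe_endoEmb σ h a))
  -- `w` commutes with `ι a`
  have h1 : w * endoEmb σ J₂ J₁ J₃ h a = endoEmb σ J₂ J₁ J₃ h a * w := Subgroup.mem_centralizer_singleton_iff.mp hw
  have h2 := congrArg (fun u : unitaryGroupOfForm σ J₃ => ((u : GL (Fin 3) S) : Matrix (Fin 3) (Fin 3) S)) h1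
  simp only [Subgroup.coe_mul, Units.val_mul] at h2
  exact h2

end Endo

/-! ## §2 The CM carriers of the floor-0 line -/

section CM

variable (L : Type) [Field L] [NumberField L] [IsCMField L] {H' : Matrix (Fin 3) (Fin 3) L}

omit [IsCMField L] in
/-- `2` is a unit of the adèle ring `𝔸_L` (image of `2 ∈ L^×`). [cite: Rogawski1990, §4.3 p. 42] -/
theorem isUnit_two_adeleRing : IsUnit (2 : AdeleRing (𝓞 L) L) := by
  have h := (isUnit_iff_ne_zero.mpr (two_ne_zero : (2 : L) ≠ 0)).map (algebraMap L (AdeleRing (𝓞 L) L))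
  rwa [map_ofNat] at h

omit [IsCMField L] in
/-- `2` is a unit of `L ⊗ L⁺_v = ∏_{w∣v} L_w` (image of `2 ∈ 𝔸_L^×`). [cite: Rogawski1990, §4.3 p. 42] -/
theorem isUnit_two_localRing (v : HeightOneSpectrum (𝓞 ↥(maximalRealSubfield L))) : IsUnit (2 : LocalRing L v) := by
  have h := (isUnit_two_adeleRing L).map (adeleToLocal L v)
  rwa [map_ofNat] at h

omit [NumberField L] [IsCMField L] in
/-- `2` is a unit of `L ⊗ ℝ = ℝ^{r₁} × ℂ^{r₂}`. [cite: Rogawski1990, §4.3 p. 42] -/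
theorem isUnit_two_mixedSpace : IsUnit (2 : mixedEmbedding.mixedSpace L) := by
  have h := (isUnit_iff_ne_zero.mpr (two_ne_zero : (2 : ℝ) ≠ 0)).map (algebraMap ℝ (mixedEmbedding.mixedSpace L))
  rwa [map_ofNat] at h

/-! ### Rational points: `Z_{H(L⁺)}(γ_H) ≃* Z_{U(H′)(L⁺)}(γ)` -/

/-- **RATIONAL `Z_{H(L⁺)}(γ_H) ≃* Z_{U(H′)(L⁺)}(γ)`** for `γ_H ∈ H(L⁺) = U(Φ₂)(L⁺) × U(Φ₁)(L⁺)` `G`-regular and `γ ∈ U(H′)(L⁺)` with `γ_H → γ`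
(★ `IsNormPair`), `det H′ ≠ 0`: value `y · ι(z) · y⁻¹` for ANY rational conjugator `y` of `ι(γ_H)` to `γ`. [cite: Rogawski1990, §4.3 pp. 42–44; §14.1 p. 232] -/
theorem exists_rationalEndoCentralizerEquiv (hH' : H'.det ≠ 0)
    {γH : (cmDatum L 2 (Matrix.of fun i j : Fin 2 => if i.val + j.val + 1 = 2 then (1 : L) else 0)).Rational ×
      (cmDatum L 1 (Matrix.of fun i j : Fin 1 => if i.val + j.val + 1 = 1 then (1 : L) else 0)).Rational}
    {γ : (cmDatum L 3 H').Rational}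
    (hreg : IsGRegular (cmConjRingHom L) (Matrix.of fun i j : Fin 2 => if i.val + j.val + 1 = 2 then (1 : L) else 0)
      (Matrix.of fun i j : Fin 1 => if i.val + j.val + 1 = 1 then (1 : L) else 0)
      (Matrix.of fun i j : Fin 3 => if i.val + j.val + 1 = 3 then (1 : L) else 0) endoForm_antidiagOne γH)
    (hm : IsNormPair L H' γH γ) :
    ∃ e : Subgroup.centralizer ({γH} : Set ((cmDatum L 2 (Matrix.of fun i j : Fin 2 => if i.val + j.val + 1 = 2 then (1 : L) else 0)).Rational ×
          (cmDatum L 1 (Matrix.of fun i j : Fin 1 => if i.val + j.val + 1 = 1 then (1 : L) else 0)).Rational)) ≃*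
        Subgroup.centralizer ({γ} : Set (cmDatum L 3 H').Rational),
      ∀ (y : GL (Fin 3) L), y * ((endoEmbRational L γH).val : GL (Fin 3) L) * y⁻¹ = γ.val →
        ∀ z, ((e z).1.val : GL (Fin 3) L) = y * ((endoEmbRational L z.1).val : GL (Fin 3) L) * y⁻¹ := by
  obtain ⟨e₁, he₁⟩ := exists_mulEquiv_centralizer_of_injective (endoEmbRational L) (endoEmbRational_injective L) γH fun w hw =>
    mem_range_endoEmb_of_mem_centralizer (isUnit_iff_ne_zero.mpr two_ne_zero) γH
      (commute_of_commute_of_isRegularElt_rational L (endoEmbRational L γH) hreg) hw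
  refine ⟨e₁.trans (rationalStableCentralizerEquiv L (isUnit_antidiagOne_det L 3).ne_zero hH' hm hreg), fun y hy z => ?_⟩
  rw [MulEquiv.trans_apply, coe_rationalStableCentralizerEquiv, ← he₁ z]
  exact conj_eq_conj_of_conj_eq (commute_of_commute_of_isRegularElt_rational L (endoEmbRational L γH) hreg)
    (Corresponds.conjugator_spec hm) hy (congrArg Subtype.val (Subgroup.mem_centralizer_singleton_iff.mp (e₁ z).2))

/-! ### Local points at a finite place: `Z_{H(L⁺_v)}(γ_H) ≃ₜ* Z_{U(H′)(L⁺_v)}(γ)` -/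

/-- **LOCAL `Z_{H(L⁺_v)}(γ_H) ≃ₜ* Z_{U(H′)(L⁺_v)}(γ)`** at a finite place `v` of `L⁺`, for `γ_H ∈ H_v = U(Φ₂)(L⁺_v) × U(Φ₁)(L⁺_v)` `G`-regular
(★ `IsLocalGRegular`) and `γ ∈ U(H′)(L⁺_v)` with `γ_H → γ` (★ `IsLocalNormPair`), `det H′ ≠ 0`: value `y · ι_v(z) · y⁻¹` for ANY conjugator `y ∈ GL₃(∏_{w∣v} L_w)`.
[cite: Rogawski1990, §4.3 pp. 42–44] -/
theorem exists_localEndoCentralizerEquiv (v : HeightOneSpectrum (𝓞 ↥(maximalRealSubfield L))) (hH' : H'.det ≠ 0)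
    {γH : (cmDatum L 2 (Matrix.of fun i j : Fin 2 => if i.val + j.val + 1 = 2 then (1 : L) else 0)).Local v ×
      (cmDatum L 1 (Matrix.of fun i j : Fin 1 => if i.val + j.val + 1 = 1 then (1 : L) else 0)).Local v}
    {γ : (cmDatum L 3 H').Local v} (hreg : IsLocalGRegular L v γH) (hm : IsLocalNormPair L H' v γH γ) :
    ∃ e : Subgroup.centralizer ({γH} : Set ((cmDatum L 2 (Matrix.of fun i j : Fin 2 => if i.val + j.val + 1 = 2 then (1 : L) else 0)).Local v ×
          (cmDatum L 1 (Matrix.of fun i j : Fin 1 => if i.val + j.val + 1 = 1 then (1 : L) else 0)).Local v)) ≃ₜ*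
        Subgroup.centralizer ({γ} : Set ((cmDatum L 3 H').Local v)),
      ∀ (y : GL (Fin 3) (LocalRing L v)), y * ((endoEmbLocal L v γH).val : GL (Fin 3) (LocalRing L v)) * y⁻¹ = γ.val →
        ∀ z, ((e z).1.val : GL (Fin 3) (LocalRing L v)) = y * ((endoEmbLocal L v z.1).val : GL (Fin 3) (LocalRing L v)) * y⁻¹ := by
  obtain ⟨e₁, he₁⟩ := exists_continuousMulEquiv_centralizer_of_isInducing (endoEmbLocal L v)
    (isClosedEmbedding_endoEmbLocal L v).isInducing (endoEmbLocal_injective L v) γH fun w hw =>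
    mem_range_endoEmb_of_mem_centralizer (isUnit_two_localRing L v) γH (commute_of_commute_of_isRegularElt_local L v (endoEmbLocal L v γH) hreg) hw
  refine ⟨e₁.trans (localStableCentralizerEquiv L v (isUnit_antidiagOne_det L 3).ne_zero hH' hm hreg), fun y hy z => ?_⟩
  rw [ContinuousMulEquiv.trans_apply, ← he₁ z]
  exact coe_localStableCentralizerEquiv_eq_of_conj_eq L v _ hH' hm hreg y hy (e₁ z)

/-! ### Archimedean points: `Z_{H_∞}(γ_H) ≃ₜ* Z_{G′_∞}(γ)` -/

/-- **ARCHIMEDEAN `Z_{H_∞}(γ_H) ≃ₜ* Z_{G′_∞}(γ)`** for `γ_H ∈ H_∞ = U(Φ₂)(L⁺ ⊗ ℝ) × U(Φ₁)(L⁺ ⊗ ℝ)` `G`-regular (★ `IsArchGRegular`) and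
`γ ∈ G′_∞ = U(H′)(L⁺ ⊗ ℝ)` with `γ_H → γ` (★ `IsArchNormPair`), `det H′ ≠ 0`: the endoscopic torus embedding of the archimedean coherence conditions
(SPEC-ed1.19 §0 (C-arch)), value `y · ι_∞(z) · y⁻¹` for ANY conjugator `y ∈ GL₃(L ⊗ ℝ)`. [cite: Rogawski1990, §4.3 pp. 42–44; §14.3 p. 234] -/
theorem exists_archEndoCentralizerEquiv (hH' : H'.det ≠ 0)
    {γH : UnitaryGroup.arch (↥(maximalRealSubfield L)) L (IsCMField.complexConj L) 2 (Matrix.of fun i j : Fin 2 => if i.val + j.val + 1 = 2 then (1 : L) else 0) ×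
      UnitaryGroup.arch (↥(maximalRealSubfield L)) L (IsCMField.complexConj L) 1 (Matrix.of fun i j : Fin 1 => if i.val + j.val + 1 = 1 then (1 : L) else 0)}
    {γ : UnitaryGroup.arch (↥(maximalRealSubfield L)) L (IsCMField.complexConj L) 3 H'}
    (hreg : IsArchGRegular L γH) (hm : IsArchNormPair L H' γH γ) :
    ∃ e : Subgroup.centralizer ({γH} : Set (UnitaryGroup.arch (↥(maximalRealSubfield L)) L (IsCMField.complexConj L) 2
            (Matrix.of fun i j : Fin 2 => if i.val + j.val + 1 = 2 then (1 : L) else 0) ×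
          UnitaryGroup.arch (↥(maximalRealSubfield L)) L (IsCMField.complexConj L) 1 (Matrix.of fun i j : Fin 1 => if i.val + j.val + 1 = 1 then (1 : L) else 0))) ≃ₜ*
        Subgroup.centralizer ({γ} : Set (UnitaryGroup.arch (↥(maximalRealSubfield L)) L (IsCMField.complexConj L) 3 H')),
      ∀ (y : GL (Fin 3) (mixedEmbedding.mixedSpace L)), y * ((endoEmbArch L γH).val : GL (Fin 3) (mixedEmbedding.mixedSpace L)) * y⁻¹ = γ.val →
        ∀ z, ((e z).1.val : GL (Fin 3) (mixedEmbedding.mixedSpace L)) = y * ((endoEmbArch L z.1).val : GL (Fin 3) (mixedEmbedding.mixedSpace L)) * y⁻¹ := by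
  obtain ⟨e₁, he₁⟩ := exists_continuousMulEquiv_centralizer_of_isInducing (endoEmbArch L)
    (isClosedEmbedding_endoEmbArch L).isInducing (endoEmbArch_injective L) γH fun w hw =>
    mem_range_endoEmb_of_mem_centralizer (isUnit_two_mixedSpace L) γH (commute_of_commute_of_isRegularElt_arch L (endoEmbArch L γH) hreg) hw
  refine ⟨e₁.trans (archStableCentralizerEquiv L (isUnit_antidiagOne_det L 3).ne_zero hH' hm hreg), fun y hy z => ?_⟩
  rw [ContinuousMulEquiv.trans_apply, ← he₁ z]
  exact coe_archStableCentralizerEquiv_eq_of_conj_eq L _ hH' hm hreg y hy (e₁ z)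

/-! ### Adelic points, from rational data: rational points ↦ rational points -/

/-- **`ι_𝔸(g)` is RATIONAL iff `g` is**: `ι_𝔸(g₂, g₁) ∈ U(Φ₃)(L⁺) ⊗ 1` iff `g₂ ∈ U(Φ₂)(L⁺) ⊗ 1` and `g₁ ∈ U(Φ₁)(L⁺) ⊗ 1` (the arithmetic subgroups ★
`AdelicGroupData.arithmeticSubgroup = range toAdelic`): a rational matrix of the block pattern over `𝔸_L` has the block pattern over `L` (`L → 𝔸_L` is
injective), so it is `ι_F` of a rational pair, and `ι_𝔸` is injective. [cite: Rogawski1990, §4.9 p. 54] -/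
theorem endoEmbAdelic_mem_arithmeticSubgroup_iff
    (g : (cmDatum L 2 (Matrix.of fun i j : Fin 2 => if i.val + j.val + 1 = 2 then (1 : L) else 0)).Adelic ×
      (cmDatum L 1 (Matrix.of fun i j : Fin 1 => if i.val + j.val + 1 = 1 then (1 : L) else 0)).Adelic) :
    endoEmbAdelic L g ∈ (cmDatum L 3 (Matrix.of fun i j : Fin 3 => if i.val + j.val + 1 = 3 then (1 : L) else 0)).arithmeticSubgroup ↔
      g.1 ∈ (cmDatum L 2 (Matrix.of fun i j : Fin 2 => if i.val + j.val + 1 = 2 then (1 : L) else 0)).arithmeticSubgroup ∧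
        g.2 ∈ (cmDatum L 1 (Matrix.of fun i j : Fin 1 => if i.val + j.val + 1 = 1 then (1 : L) else 0)).arithmeticSubgroup := by
  constructor
  · rintro ⟨γ₃, hγ₃⟩
    -- the rational `γ₃` has the block pattern: its off-pattern entries vanish in `𝔸_L`, hence in `L`
    have hpat := (mem_range_endoEmb_iff_apply _ _ (endoEmbAdelic L g)).mp ⟨g, rfl⟩
    have hent : ∀ i j : Fin 3, (((endoEmbAdelic L g).val : GL (Fin 3) (AdeleRing (𝓞 L) L)) : Matrix (Fin 3) (Fin 3) (AdeleRing (𝓞 L) L)) i j =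
        algebraMap L (AdeleRing (𝓞 L) L) (((γ₃.val : GL (Fin 3) L) : Matrix (Fin 3) (Fin 3) L) i j) := fun i j => by
      rw [← hγ₃, coe_toAdelic_val_eq_map, Matrix.map_apply]
    have hinj : Function.Injective (algebraMap L (AdeleRing (𝓞 L) L)) := AdeleRing.algebraMap_injective (𝓞 L) L
    have hz : ∀ i j : Fin 3, (((endoEmbAdelic L g).val : GL (Fin 3) (AdeleRing (𝓞 L) L)) : Matrix (Fin 3) (Fin 3) (AdeleRing (𝓞 L) L)) i j = 0 →
        ((γ₃.val : GL (Fin 3) L) : Matrix (Fin 3) (Fin 3) L) i j = 0 := fun i j hij => hinj (by rw [← hent, hij, map_zero])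
    obtain ⟨δ, hδ⟩ := (mem_range_endoEmb_iff_apply _ _ γ₃).mpr ⟨hz 0 1 hpat.1, hz 1 0 hpat.2.1, hz 1 2 hpat.2.2.1, hz 2 1 hpat.2.2.2⟩
    -- `ι_𝔸 g = toAdelic (ι_F δ) = ι_𝔸 (toAdelic δ₁, toAdelic δ₂)`, so `g = (toAdelic δ₁, toAdelic δ₂)`
    have hg : g = ((cmDatum L 2 (Matrix.of fun i j : Fin 2 => if i.val + j.val + 1 = 2 then (1 : L) else 0)).toAdelic δ.1,
        (cmDatum L 1 (Matrix.of fun i j : Fin 1 => if i.val + j.val + 1 = 1 then (1 : L) else 0)).toAdelic δ.2) := by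
      apply endoEmbAdelic_injective L
      rw [← toAdelic_endoEmbRational, ← hγ₃]
      exact congrArg _ hδ.symm
    rw [hg]
    exact ⟨⟨δ.1, rfl⟩, ⟨δ.2, rfl⟩⟩
  · rintro ⟨⟨δ₂, h₂⟩, ⟨δ₁, h₁⟩⟩
    have hg : g = ((cmDatum L 2 (Matrix.of fun i j : Fin 2 => if i.val + j.val + 1 = 2 then (1 : L) else 0)).toAdelic δ₂,
        (cmDatum L 1 (Matrix.of fun i j : Fin 1 => if i.val + j.val + 1 = 1 then (1 : L) else 0)).toAdelic δ₁) := Prod.ext h₂.symm h₁.symm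
    rw [hg]
    exact endoEmbAdelic_toAdelic_mem_range L (δ₂, δ₁)

/-- **ADELIC `Z_{H(𝔸)}(γ_H ⊗ 1) ≃ₜ* Z_{U(H′)(𝔸)}(γ ⊗ 1)` from RATIONAL data**: `γ_H ∈ H(L⁺)` `G`-regular, `γ ∈ U(H′)(L⁺)` with `γ_H → γ` (★ `IsNormPair`),
`det H′ ≠ 0`.  The isomorphism (i) has value `(y ⊗ 1) · ι_𝔸(z) · (y ⊗ 1)⁻¹` for ANY rational conjugator `y ∈ GL₃(L)` of `ι(γ_H)` to `γ`, and (ii) carries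
the RATIONAL points of the source centraliser (both coordinates in the arithmetic subgroups) onto the rational points of the target — the lattice hypothesis
`∀ g, e g ∈ Γ′ ↔ g ∈ Γ` of ★ `Literature.MeasureTheory.Group.covolume_count_eq_of_mulEquiv`, under which the torus covolumes `m(T_H(L⁺) \ T_H(𝔸))` and
`m(T(L⁺) \ T(𝔸))` for transported Haar measures agree (print: compatible measures on `H_{γ_H}` and `G_γ`, §4.3 p. 43).
[cite: Rogawski1990, §4.3 pp. 42–44; §14.5 pp. 237–238] -/
theorem exists_adelicEndoCentralizerEquiv (hH' : H'.det ≠ 0)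
    {γH : (cmDatum L 2 (Matrix.of fun i j : Fin 2 => if i.val + j.val + 1 = 2 then (1 : L) else 0)).Rational ×
      (cmDatum L 1 (Matrix.of fun i j : Fin 1 => if i.val + j.val + 1 = 1 then (1 : L) else 0)).Rational}
    {γ : (cmDatum L 3 H').Rational}
    (hreg : IsGRegular (cmConjRingHom L) (Matrix.of fun i j : Fin 2 => if i.val + j.val + 1 = 2 then (1 : L) else 0)
      (Matrix.of fun i j : Fin 1 => if i.val + j.val + 1 = 1 then (1 : L) else 0)
      (Matrix.of fun i j : Fin 3 => if i.val + j.val + 1 = 3 then (1 : L) else 0) endoForm_antidiagOne γH)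
    (hm : IsNormPair L H' γH γ) :
    ∃ e : Subgroup.centralizer
          ({((cmDatum L 2 (Matrix.of fun i j : Fin 2 => if i.val + j.val + 1 = 2 then (1 : L) else 0)).toAdelic γH.1,
             (cmDatum L 1 (Matrix.of fun i j : Fin 1 => if i.val + j.val + 1 = 1 then (1 : L) else 0)).toAdelic γH.2)} :
            Set ((cmDatum L 2 (Matrix.of fun i j : Fin 2 => if i.val + j.val + 1 = 2 then (1 : L) else 0)).Adelic ×
              (cmDatum L 1 (Matrix.of fun i j : Fin 1 => if i.val + j.val + 1 = 1 then (1 : L) else 0)).Adelic)) ≃ₜ*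
        Subgroup.centralizer ({(cmDatum L 3 H').toAdelic γ} : Set (cmDatum L 3 H').Adelic),
      (∀ (y : GL (Fin 3) L), y * ((endoEmbRational L γH).val : GL (Fin 3) L) * y⁻¹ = γ.val →
        ∀ z, ((e z).1.val : GL (Fin 3) (AdeleRing (𝓞 L) L)) = toAdeleGL L y * ((endoEmbAdelic L z.1).val : GL (Fin 3) (AdeleRing (𝓞 L) L)) * (toAdeleGL L y)⁻¹) ∧
      (∀ z, (e z).1 ∈ (cmDatum L 3 H').arithmeticSubgroup ↔
        z.1.1 ∈ (cmDatum L 2 (Matrix.of fun i j : Fin 2 => if i.val + j.val + 1 = 2 then (1 : L) else 0)).arithmeticSubgroup ∧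
          z.1.2 ∈ (cmDatum L 1 (Matrix.of fun i j : Fin 1 => if i.val + j.val + 1 = 1 then (1 : L) else 0)).arithmeticSubgroup) := by
  -- abbreviations
  set Φ₃ : Matrix (Fin 3) (Fin 3) L := Matrix.of fun i j : Fin 3 => if i.val + j.val + 1 = 3 then (1 : L) else 0 with hΦ₃
  set aA : (cmDatum L 2 (Matrix.of fun i j : Fin 2 => if i.val + j.val + 1 = 2 then (1 : L) else 0)).Adelic ×
      (cmDatum L 1 (Matrix.of fun i j : Fin 1 => if i.val + j.val + 1 = 1 then (1 : L) else 0)).Adelic :=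
    ((cmDatum L 2 (Matrix.of fun i j : Fin 2 => if i.val + j.val + 1 = 2 then (1 : L) else 0)).toAdelic γH.1,
      (cmDatum L 1 (Matrix.of fun i j : Fin 1 => if i.val + j.val + 1 = 1 then (1 : L) else 0)).toAdelic γH.2) with haA
  -- `ι_𝔸 (γ_H ⊗ 1) = ι(γ_H) ⊗ 1`
  have hιa : endoEmbAdelic L aA = (cmDatum L 3 Φ₃).toAdelic (endoEmbRational L γH) := (toAdelic_endoEmbRational L γH).symm
  -- the `GL₃(𝔸_L)`-commutant of `ι_𝔸 (γ_H ⊗ 1)` is commutative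
  have hcomm : ∀ B C : Matrix (Fin 3) (Fin 3) (AdeleRing (𝓞 L) L),
      Commute B (((endoEmbAdelic L aA).val : GL (Fin 3) (AdeleRing (𝓞 L) L)) : Matrix (Fin 3) (Fin 3) (AdeleRing (𝓞 L) L)) →
      Commute C (((endoEmbAdelic L aA).val : GL (Fin 3) (AdeleRing (𝓞 L) L)) : Matrix (Fin 3) (Fin 3) (AdeleRing (𝓞 L) L)) → Commute B C := by
    rw [hιa]
    exact commute_of_commute_toAdelic_of_isRegularElt L (endoEmbRational L γH) hreg
  -- step 1: `Z_{H(𝔸)}(γ_H ⊗ 1) ≃ₜ* Z_{U(Φ₃)(𝔸)}(ι(γ_H) ⊗ 1)`, underlying map `ι_𝔸`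
  obtain ⟨e₁, he₁⟩ : ∃ e₁ : Subgroup.centralizer ({aA} : Set ((cmDatum L 2 (Matrix.of fun i j : Fin 2 => if i.val + j.val + 1 = 2 then (1 : L) else 0)).Adelic ×
          (cmDatum L 1 (Matrix.of fun i j : Fin 1 => if i.val + j.val + 1 = 1 then (1 : L) else 0)).Adelic)) ≃ₜ*
        Subgroup.centralizer ({(cmDatum L 3 Φ₃).toAdelic (endoEmbRational L γH)} : Set (cmDatum L 3 Φ₃).Adelic),
      ∀ z, (e₁ z).1 = endoEmbAdelic L z.1 := by
    rw [← hιa]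
    exact exists_continuousMulEquiv_centralizer_of_isInducing (endoEmbAdelic L) (isClosedEmbedding_endoEmbAdelic L).isInducing
      (endoEmbAdelic_injective L) aA fun w hw => mem_range_endoEmb_of_mem_centralizer (isUnit_two_adeleRing L) aA hcomm hw
  -- step 2: `Z_{U(Φ₃)(𝔸)}(ι(γ_H) ⊗ 1) ≃ₜ* Z_{U(H′)(𝔸)}(γ ⊗ 1)` (★ (S-B))
  let e₂ := adelicStableCentralizerEquiv L (isUnit_antidiagOne_det L 3).ne_zero hH' hm hreg
  refine ⟨e₁.trans e₂, fun y hy z => ?_, fun z => ?_⟩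
  · rw [ContinuousMulEquiv.trans_apply, ← he₁ z]
    exact coe_adelicStableCentralizerEquiv_eq_of_conj_eq L _ hH' hm hreg y hy (e₁ z)
  · rw [ContinuousMulEquiv.trans_apply]
    have h2 := adelicStableCentralizerEquiv_mem_arithmeticSubgroup_iff L (isUnit_antidiagOne_det L 3).ne_zero hH' hm hreg (e₁ z)
    rw [Subgroup.mem_subgroupOf, Subgroup.mem_subgroupOf] at h2
    rw [h2, he₁ z, endoEmbAdelic_mem_arithmeticSubgroup_iff]

end CM

/-! ## §3 The line's (C_H) datum `endoEmbArchCentralizer` is an isomorphism of topological groups for `G`-regular `γ_H` -/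

section ArchCentralizer

variable (L : Type) [Field L] [NumberField L] [IsCMField L]
  {γH : UnitaryGroup.arch (↥(maximalRealSubfield L)) L (IsCMField.complexConj L) 2 (Matrix.of fun i j : Fin 2 => if i.val + j.val + 1 = 2 then (1 : L) else 0) ×
    UnitaryGroup.arch (↥(maximalRealSubfield L)) L (IsCMField.complexConj L) 1 (Matrix.of fun i j : Fin 1 => if i.val + j.val + 1 = 1 then (1 : L) else 0)}

/-- **`ι_∞|_{Z(γ_H)} : Z_{H_∞}(γ_H) →* Z_{G_∞}(ι_∞ γ_H)` is BIJECTIVE for `G`-regular `γ_H`** (★ `endoEmbArchCentralizer`, the hom of the line's archimedean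
coherence condition (C_H)). [cite: Rogawski1990, §4.3 pp. 42–44] -/
theorem endoEmbArchCentralizer_bijective
    (hreg : IsArchGRegular L γH) : Function.Bijective (endoEmbArchCentralizer L γH) :=
  codRestrict_centralizer_bijective (endoEmbArch L) (endoEmbArch_injective L) γH fun _ hw =>
    mem_range_endoEmb_of_mem_centralizer (isUnit_two_mixedSpace L) γH (commute_of_commute_of_isRegularElt_arch L (endoEmbArch L γH) hreg) hw

/-- `ι_∞|_{Z(γ_H)}` is an EMBEDDING of topological spaces (★ `isClosedEmbedding_endoEmbArch`). [cite: Rogawski1990, §4.3 pp. 42–44] -/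
theorem isEmbedding_endoEmbArchCentralizer : IsEmbedding (endoEmbArchCentralizer L γH) :=
  ⟨(IsInducing.subtypeVal.of_comp_iff).mp (by
      change IsInducing (endoEmbArch L ∘ (Subtype.val : Subgroup.centralizer ({γH} : Set _) → _))
      exact (isClosedEmbedding_endoEmbArch L).isInducing.comp IsInducing.subtypeVal),
    endoEmbArchCentralizer_injective L γH⟩

/-- **`ι_∞|_{Z(γ_H)}` is a HOMEOMORPHISM onto `Z_{G_∞}(ι_∞ γ_H)`** for `G`-regular `γ_H`. [cite: Rogawski1990, §4.3 pp. 42–44] -/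
theorem isHomeomorph_endoEmbArchCentralizer
    (hreg : IsArchGRegular L γH) : IsHomeomorph (endoEmbArchCentralizer L γH) :=
  (isHomeomorph_iff_isEmbedding_surjective).mpr ⟨isEmbedding_endoEmbArchCentralizer L (γH := γH), (endoEmbArchCentralizer_bijective L hreg).2⟩

/-- **`ι_∞|_{Z(γ_H)}` underlies an isomorphism of topological groups `Z_{H_∞}(γ_H) ≃ₜ* Z_{G_∞}(ι_∞ γ_H)`** for `G`-regular `γ_H`.
[cite: Rogawski1990, §4.3 pp. 42–44] -/
theorem exists_continuousMulEquiv_coe_eq_endoEmbArchCentralizer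
    (hreg : IsArchGRegular L γH) :
    ∃ e : Subgroup.centralizer ({γH} : Set _) ≃ₜ* Subgroup.centralizer ({endoEmbArch L γH} : Set _), ⇑e = ⇑(endoEmbArchCentralizer L γH) := by
  let e₀ := MulEquiv.ofBijective (endoEmbArchCentralizer L γH) (endoEmbArchCentralizer_bijective L hreg)
  let eh := e₀.toEquiv.toHomeomorphOfIsInducing (isEmbedding_endoEmbArchCentralizer L (γH := γH)).isInducing
  exact ⟨{ e₀ with continuous_toFun := eh.continuous, continuous_invFun := eh.symm.continuous }, rfl⟩

variable [MeasurableSpace (UnitaryGroup.arch (↥(maximalRealSubfield L)) L (IsCMField.complexConj L) 2 (Matrix.of fun i j : Fin 2 => if i.val + j.val + 1 = 2 then (1 : L) else 0) ×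
    UnitaryGroup.arch (↥(maximalRealSubfield L)) L (IsCMField.complexConj L) 1 (Matrix.of fun i j : Fin 1 => if i.val + j.val + 1 = 1 then (1 : L) else 0))]
  [BorelSpace (UnitaryGroup.arch (↥(maximalRealSubfield L)) L (IsCMField.complexConj L) 2 (Matrix.of fun i j : Fin 2 => if i.val + j.val + 1 = 2 then (1 : L) else 0) ×
    UnitaryGroup.arch (↥(maximalRealSubfield L)) L (IsCMField.complexConj L) 1 (Matrix.of fun i j : Fin 1 => if i.val + j.val + 1 = 1 then (1 : L) else 0))]
  [MeasurableSpace (UnitaryGroup.arch (↥(maximalRealSubfield L)) L (IsCMField.complexConj L) 3 (Matrix.of fun i j : Fin 3 => if i.val + j.val + 1 = 3 then (1 : L) else 0))]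
  [BorelSpace (UnitaryGroup.arch (↥(maximalRealSubfield L)) L (IsCMField.complexConj L) 3 (Matrix.of fun i j : Fin 3 => if i.val + j.val + 1 = 3 then (1 : L) else 0))]

/-- **The (C_H) transport of a Haar measure is a Haar measure**: for `G`-regular `γ_H ∈ H_∞` and a Haar measure `t` on the torus `Z_{H_∞}(γ_H)`,
`map (endoEmbArchCentralizer L γ_H) t` is a Haar measure on `Z_{G_∞}(ι_∞ γ_H)` — so in ED 1.19a's (C_H) `map ι_∞|_{Z(γ_H)} (t_H γ_H) = t (ι_∞ γ_H)` both sides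
are Haar measures on the torus `T ≅ T_H` (print: compatible Haar measures on `H_{γ_H}` and `G_γ`). [cite: Rogawski1990, §4.3 p. 43; §14.3 p. 234] -/
theorem isHaarMeasure_map_endoEmbArchCentralizer
    (hreg : IsArchGRegular L γH) (t : Measure (Subgroup.centralizer ({γH} : Set _))) [t.IsHaarMeasure] :
    (Measure.map (endoEmbArchCentralizer L γH) t).IsHaarMeasure := by
  obtain ⟨e, he⟩ := exists_continuousMulEquiv_coe_eq_endoEmbArchCentralizer L hreg
  rw [← he]
  exact e.isHaarMeasure_map t

/-- The (C_H) transport of a measure FINITE ON COMPACTS is finite on compacts (a homeomorphism pulls compact sets back to compact sets).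
[cite: Rogawski1990, §4.3 p. 43] -/
theorem isFiniteMeasureOnCompacts_map_endoEmbArchCentralizer
    (hreg : IsArchGRegular L γH) (t : Measure (Subgroup.centralizer ({γH} : Set _))) [IsFiniteMeasureOnCompacts t] :
    IsFiniteMeasureOnCompacts (Measure.map (endoEmbArchCentralizer L γH) t) := by
  obtain ⟨e, he⟩ := exists_continuousMulEquiv_coe_eq_endoEmbArchCentralizer L hreg
  rw [← he]
  exact MeasureTheory.Measure.IsFiniteMeasureOnCompacts.map t e.toHomeomorph

end ArchCentralizer

end Literature.NumberTheory.Rogawski1990
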